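import Literature.Probability.RandomPlanarGeometry.BrownianExitInterval
import Mathlib.Analysis.SpecificLimits.Normed
import HarnessLib

/-!
# Exit of Brownian motion from an interval: geometric tail and second moment of the exit time

Topic `Probability/RandomPlanarGeometry`; theorems only (no definition, no named fact).
Continuation of `BrownianExitInterval`: for the canonical Brownian motion `B` and levels
`a < 0 < b`, the exit time `τ` of `(a, b)` has a **geometric tail on the time scale `(b - a)²`**,

  `P[k (b - a)² < τ] ≤ θ₀ ^ k`,  `θ₀ = P[|N(0,1)| < 1] < 1`

(`measure_mul_lt_exitTime_brownian_le_pow`): by the weak Markov property at the fixed time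
`s = k (b-a)²` (independence of the increment `B_t - B_s` from `𝓕ᵂ_s`, Mathlib/`LocalMartingaleProofs`)
a path still inside `(a, b)` at time `t = s + (b-a)²` has made an increment of size `< b - a`,
an event of probability `P[|N(0, (b-a)²)| < b - a] = θ₀` (Gaussian scaling). Consequently the
real-valued exit time `brownianExitTimeReal a b` has moments of all orders; we record the bound
consumed by the Skorokhod embedding (Lawler–Schramm–Werner (2004), proof of Thm. 3.7 after
Lemma 3.8: "`E[(τ_{n+1} - τ_n)² | B[0, τ_n]] = O(δ⁴)`"; Durrett (2019), Exercise 8.1.1):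

  `E[τ²] ≤ 2 / (1 - θ₀)² · (b - a)⁴`  (`integral_brownianExitTimeReal_sq_le`).

## References

* R. Durrett, *Probability: Theory and Examples*, 5th ed. (2019), §7.5 (Thm. 7.5.5, Thm. 7.5.9,
  Exercise 7.5.4) and Exercise 8.1.1.
* G. F. Lawler, O. Schramm, W. Werner, Ann. Probab. 32 (2004), Lemma 3.8 and proof of Thm. 3.7.
-/

noncomputable section

open MeasureTheory ProbabilityTheory Filter Set
open scoped NNReal ENNReal Topology

namespace Literature.Probability.RandomPlanarGeometry

open Literature.Probability.Process

variable {a b : ℝ}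

/-! ### The Gaussian constant `θ₀ = P[|N(0,1)| < 1]` -/

/-- **`θ₀ = P[|N(0,1)| < 1] < 1`**: the standard Gaussian charges `[1, ∞)` (its density is
everywhere positive; cf. `Literature.Analysis.UnboundedOperators.gaussianReal_pos_of_volume_pos`,
not imported here to keep the import closure probabilistic). [folklore] -/
theorem gaussianReal_Ioo_neg_one_one_lt_one : gaussianReal 0 1 (Ioo (-1) 1) < 1 := by
  have hpos : 0 < gaussianReal 0 1 (Ici 1) := by
    rw [gaussianReal_apply _ one_ne_zero, setLIntegral_pos_iff (measurable_gaussianPDF _ _),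
      support_gaussianPDF one_ne_zero, Set.univ_inter]
    simp
  have hsub : Ioo (-1 : ℝ) 1 ⊆ (Ici 1)ᶜ := fun x hx h ↦ (not_le.2 hx.2) h
  calc gaussianReal 0 1 (Ioo (-1) 1) ≤ gaussianReal 0 1 (Ici 1)ᶜ := measure_mono hsub
    _ = 1 - gaussianReal 0 1 (Ici 1) := prob_compl_eq_one_sub measurableSet_Ici
    _ < 1 := ENNReal.sub_lt_self ENNReal.one_ne_top one_ne_zero hpos.ne'

/-- `θ₀ < 1`, real-valued form. [folklore] -/
theorem gaussianReal_real_Ioo_neg_one_one_lt_one : (gaussianReal 0 1).real (Ioo (-1) 1) < 1 := by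
  rw [measureReal_def, ← ENNReal.toReal_one]
  exact (ENNReal.toReal_lt_toReal (measure_ne_top _ _) ENNReal.one_ne_top).2
    gaussianReal_Ioo_neg_one_one_lt_one

/-- **Gaussian scaling**: `P[|N(0, L²)| < L] = P[|N(0, 1)| < 1]` for `L > 0`. [folklore] -/
theorem gaussianReal_Ioo_eq_of_sq {L : ℝ} (hL : 0 < L) {v : ℝ≥0} (hv : (v : ℝ) = L ^ 2) :
    gaussianReal 0 v (Ioo (-L) L) = gaussianReal 0 1 (Ioo (-1) 1) := by
  have key : gaussianReal 0 v = (gaussianReal 0 1).map (fun x ↦ L * x) := by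
    rw [gaussianReal_map_const_mul]
    congr 1
    · simp
    · ext
      simp [hv]
  rw [key, Measure.map_apply (measurable_const_mul L) measurableSet_Ioo]
  congr 1
  ext x
  simp only [mem_preimage, mem_Ioo]
  constructor
  · rintro ⟨h1, h2⟩
    constructor
    · nlinarith
    · nlinarith
  · rintro ⟨h1, h2⟩
    constructor <;> nlinarith

/-! ### One weak-Markov step -/

/-- The event "not yet exited at time `s`" is `𝓕ᵂ_s`-measurable. [folklore] -/
theorem measurableSet_coe_lt_exitTime_brownian (a b : ℝ) (s : ℝ≥0) :
    MeasurableSet[brownianFiltration s]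
      {ω | (s : WithTop ℝ≥0) < Process.exitTime Process.brownian a b ω} :=
  Process.measurableSet_coe_lt_exitTime adapted_brownian Process.continuous_brownian s

/-- The event "not yet exited at time `s`" is measurable. [folklore] -/
theorem measurableSet_coe_lt_exitTime_brownian' (a b : ℝ) (s : ℝ≥0) :
    MeasurableSet {ω | (s : WithTop ℝ≥0) < Process.exitTime Process.brownian a b ω} :=
  brownianFiltration.le s _ (measurableSet_coe_lt_exitTime_brownian a b s)

/-- A path still inside `(a, b)` at the later time `t` was inside at time `s ≤ t` and made an
increment `|B_t - B_s| < b - a`. [folklore] -/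
theorem setOf_coe_lt_exitTime_subset {s t : ℝ≥0} (hst : s ≤ t) :
    {ω | (t : WithTop ℝ≥0) < Process.exitTime Process.brownian a b ω} ⊆
      {ω | (s : WithTop ℝ≥0) < Process.exitTime Process.brownian a b ω} ∩
        (Process.brownian t - Process.brownian s) ⁻¹' Ioo (-(b - a)) (b - a) := by
  intro ω hω
  have hs : (s : WithTop ℝ≥0) < Process.exitTime Process.brownian a b ω :=
    lt_of_le_of_lt (WithTop.coe_le_coe.2 hst) hω
  refine ⟨hs, ?_⟩
  have ht' := Process.mem_Ioo_of_coe_lt_exitTime hω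
  have hs' := Process.mem_Ioo_of_coe_lt_exitTime hs
  simp only [mem_preimage, Pi.sub_apply, mem_Ioo]
  constructor <;> linarith [ht'.1, ht'.2, hs'.1, hs'.2]

/-- **One weak-Markov step**: for `s ≤ t`,
`P[t < τ] ≤ P[s < τ] · P[|N(0, t - s)| < b - a]` (independence of `B_t - B_s` from `𝓕ᵂ_s`
and its Gaussian law). Durrett (2019), §7.5 (Markov property of Brownian motion).
[folklore] -/
theorem measure_coe_lt_exitTime_brownian_le_mul {s t : ℝ≥0} (hst : s ≤ t) :
    Process.preWienerMeasure {ω | (t : WithTop ℝ≥0) < Process.exitTime Process.brownian a b ω} ≤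
      Process.preWienerMeasure {ω | (s : WithTop ℝ≥0) < Process.exitTime Process.brownian a b ω} *
        gaussianReal 0 (nndist (t : ℝ) (s : ℝ)) (Ioo (-(b - a)) (b - a)) := by
  haveI := isProbabilityMeasure_preWienerMeasure'
  set X : (ℝ≥0 → ℝ) → ℝ := Process.brownian t - Process.brownian s with hX
  have hXm : Measurable X := (Process.measurable_brownian t).sub (Process.measurable_brownian s)
  -- independence of the increment from the past
  have hind := indep_comap_brownian_sub_brownianFiltration hst
  have hA : MeasurableSet[MeasurableSpace.comap X inferInstance] (X ⁻¹' Ioo (-(b - a)) (b - a)) :=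
    ⟨Ioo (-(b - a)) (b - a), measurableSet_Ioo, rfl⟩
  have hC := measurableSet_coe_lt_exitTime_brownian a b s
  have hprod := (Indep_iff _ _ _).1 hind _ _ hA hC
  -- the law of the increment
  have hlaw : Process.preWienerMeasure (X ⁻¹' Ioo (-(b - a)) (b - a)) =
      gaussianReal 0 (nndist (t : ℝ) (s : ℝ)) (Ioo (-(b - a)) (b - a)) :=
    (isPreBrownianReal_brownian.hasLaw_sub t s).measure_eq (p := fun x ↦ x ∈ Ioo (-(b - a)) (b - a))
      measurableSet_Ioo
  calc Process.preWienerMeasure {ω | (t : WithTop ℝ≥0) < Process.exitTime Process.brownian a b ω}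
      ≤ Process.preWienerMeasure ({ω | (s : WithTop ℝ≥0) < Process.exitTime Process.brownian a b ω} ∩
          X ⁻¹' Ioo (-(b - a)) (b - a)) := measure_mono (setOf_coe_lt_exitTime_subset hst)
    _ = Process.preWienerMeasure (X ⁻¹' Ioo (-(b - a)) (b - a) ∩
          {ω | (s : WithTop ℝ≥0) < Process.exitTime Process.brownian a b ω}) := by rw [inter_comm]
    _ = Process.preWienerMeasure (X ⁻¹' Ioo (-(b - a)) (b - a)) *
          Process.preWienerMeasure {ω | (s : WithTop ℝ≥0) < Process.exitTime Process.brownian a b ω} :=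
        hprod
    _ = _ := by rw [hlaw, mul_comm]

/-! ### The geometric tail on the time scale `(b - a)²` -/

/-- **Geometric tail of the Brownian exit time** (`a < b`): with the time step `h = (b - a)²`,
`P[k h < τ] ≤ θ₀ ^ k` where `θ₀ = P[|N(0,1)| < 1]`. Durrett (2019), §7.5 (the argument behind
"`T < ∞` a.s.", Thm. 7.5.3, made quantitative). [folklore] -/
theorem measure_mul_lt_exitTime_brownian_le_pow (hab : a < b) {h : ℝ≥0} (hh : (h : ℝ) = (b - a) ^ 2)
    (k : ℕ) :
    Process.preWienerMeasure
        {ω | (((k : ℝ≥0) * h : ℝ≥0) : WithTop ℝ≥0) < Process.exitTime Process.brownian a b ω} ≤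
      gaussianReal 0 1 (Ioo (-1) 1) ^ k := by
  haveI := isProbabilityMeasure_preWienerMeasure'
  induction k with
  | zero => simpa using prob_le_one
  | succ k ih =>
    have hst : (k : ℝ≥0) * h ≤ ((k + 1 : ℕ) : ℝ≥0) * h := by
      gcongr
      exact_mod_cast Nat.le_succ k
    refine (measure_coe_lt_exitTime_brownian_le_mul hst).trans ?_
    have hdist : nndist ((((k + 1 : ℕ) : ℝ≥0) * h : ℝ≥0) : ℝ) ((((k : ℝ≥0) * h : ℝ≥0) : ℝ)) = h := by
      apply NNReal.eq
      rw [coe_nndist, Real.dist_eq]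
      push_cast
      rw [show ((k : ℝ) + 1) * h - k * h = h by ring, abs_of_nonneg h.coe_nonneg]
    rw [hdist, gaussianReal_Ioo_eq_of_sq (by linarith) hh, pow_succ]
    gcongr

/-! ### The second moment of the exit time -/

/-- `∑_{k < K} (2k + 1) = K²`. [folklore] -/
theorem sum_range_two_mul_add_one (K : ℕ) :
    ∑ k ∈ Finset.range K, (2 * k + 1) = K ^ 2 := by
  induction K with
  | zero => simp
  | succ K ih => rw [Finset.sum_range_succ, ih]; ring

/-- **Discrete layer-cake bound**: for `T ≥ 0` and a step `h > 0`,
`T² ≤ h² · ∑ₖ (2k + 1) 𝟙{k h < T}` (the sum has `K = ⌈T/h⌉` nonzero terms and equals `K²`,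
while `T ≤ K h`). [folklore] -/
theorem ofReal_sq_le_mul_tsum_ite {T h : ℝ} (hT : 0 ≤ T) (hh : 0 < h) :
    ENNReal.ofReal (T ^ 2) ≤
      ENNReal.ofReal (h ^ 2) * ∑' k : ℕ, ((2 * k + 1 : ℕ) : ℝ≥0∞) * (if (k : ℝ) * h < T then 1 else 0) := by
  set K := ⌈T / h⌉₊ with hK
  have hiff : ∀ k : ℕ, (k : ℝ) * h < T ↔ k < K := fun k ↦ by
    rw [hK, Nat.lt_ceil, lt_div_iff₀ hh]
  have htsum : ∑' k : ℕ, ((2 * k + 1 : ℕ) : ℝ≥0∞) * (if (k : ℝ) * h < T then 1 else 0) =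
      ((K ^ 2 : ℕ) : ℝ≥0∞) := by
    rw [tsum_eq_sum (s := Finset.range K)]
    · rw [← sum_range_two_mul_add_one K, Nat.cast_sum]
      refine Finset.sum_congr rfl fun k hk ↦ ?_
      rw [if_pos ((hiff k).2 (Finset.mem_range.1 hk)), mul_one]
    · intro k hk
      rw [if_neg (fun h' ↦ hk (Finset.mem_range.2 ((hiff k).1 h'))), mul_zero]
  rw [htsum]
  have hTK : T ≤ K * h := by
    have := Nat.le_ceil (T / h)
    rw [div_le_iff₀ hh] at this
    exact this
  calc ENNReal.ofReal (T ^ 2) ≤ ENNReal.ofReal ((K * h) ^ 2) :=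
        ENNReal.ofReal_le_ofReal (pow_le_pow_left₀ hT hTK 2)
    _ = ENNReal.ofReal (h ^ 2) * ((K ^ 2 : ℕ) : ℝ≥0∞) := by
        rw [mul_pow, mul_comm, ENNReal.ofReal_mul (sq_nonneg _)]
        congr 1
        rw [show ((K : ℝ) ^ 2) = ((K ^ 2 : ℕ) : ℝ) by push_cast; ring, ENNReal.ofReal_natCast]

/-- The real series `∑ₖ (2k + 1) θ^k = (1 + θ)/(1 - θ)²` for `0 ≤ θ < 1`. [folklore] -/
theorem hasSum_two_mul_add_one_mul_pow {θ : ℝ} (h0 : 0 ≤ θ) (h1 : θ < 1) :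
    HasSum (fun k : ℕ ↦ ((2 * k + 1 : ℕ) : ℝ) * θ ^ k) ((1 + θ) / (1 - θ) ^ 2) := by
  have hnorm : ‖θ‖ < 1 := by rwa [Real.norm_eq_abs, abs_of_nonneg h0]
  have hA := hasSum_coe_mul_geometric_of_norm_lt_one hnorm
  have hB := hasSum_geometric_of_lt_one h0 h1
  have hsum := (hA.mul_left 2).add hB
  have hne : (1 - θ) ≠ 0 := by linarith
  have hfun : (fun k : ℕ ↦ ((2 * k + 1 : ℕ) : ℝ) * θ ^ k) =
      fun k : ℕ ↦ 2 * ((k : ℝ) * θ ^ k) + θ ^ k := by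
    funext k
    push_cast
    ring
  have hval : (1 + θ) / (1 - θ) ^ 2 = 2 * (θ / (1 - θ) ^ 2) + (1 - θ)⁻¹ := by
    field_simp
    ring
  rw [hfun, hval]
  exact hsum

/-- **Second moment of the Brownian exit time, lower-integral form** (`a < 0 < b`):
`∫⁻ τ² ≤ (b - a)⁴ · ∑ₖ (2k + 1) θ₀^k`. [folklore] -/
theorem lintegral_brownianExitTimeReal_sq_le (ha : a < 0) (hb : 0 < b) :
    ∫⁻ ω, ENNReal.ofReal (brownianExitTimeReal a b ω ^ 2) ∂Process.preWienerMeasure ≤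
      ENNReal.ofReal ((b - a) ^ 4) *
        ∑' k : ℕ, ((2 * k + 1 : ℕ) : ℝ≥0∞) * gaussianReal 0 1 (Ioo (-1) 1) ^ k := by
  haveI := isProbabilityMeasure_preWienerMeasure'
  have hab : a < b := ha.trans hb
  have hL : 0 < b - a := by linarith
  set h : ℝ≥0 := ⟨(b - a) ^ 2, sq_nonneg _⟩ with hh
  have hhr : (h : ℝ) = (b - a) ^ 2 := rfl
  have hhpos : 0 < (h : ℝ) := by rw [hhr]; positivity
  -- the events `{k h < τ}`
  set E : ℕ → Set (ℝ≥0 → ℝ) := fun k ↦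
    {ω | (((k : ℝ≥0) * h : ℝ≥0) : WithTop ℝ≥0) < Process.exitTime Process.brownian a b ω} with hE
  have hEm : ∀ k, MeasurableSet (E k) := fun k ↦ measurableSet_coe_lt_exitTime_brownian' a b _
  -- pointwise layer-cake bound
  have hpt : ∀ ω, ENNReal.ofReal (brownianExitTimeReal a b ω ^ 2) ≤
      ENNReal.ofReal ((h : ℝ) ^ 2) * ∑' k : ℕ, ((2 * k + 1 : ℕ) : ℝ≥0∞) * (E k).indicator 1 ω := by
    intro ω
    refine (ofReal_sq_le_mul_tsum_ite (brownianExitTimeReal_nonneg a b ω) hhpos).trans ?_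
    gcongr with k
    by_cases hk : (k : ℝ) * h < brownianExitTimeReal a b ω
    · rw [if_pos hk]
      have hω : ω ∈ E k := by
        simp only [hE, mem_setOf_eq]
        rcases eq_or_ne (Process.exitTime Process.brownian a b ω) ⊤ with htop | hne
        · rw [htop]; exact WithTop.coe_lt_top _
        · obtain ⟨T, hT⟩ := WithTop.ne_top_iff_exists.1 hne
          rw [brownianExitTimeReal_of_eq_coe hT.symm] at hk
          rw [← hT, WithTop.coe_lt_coe, ← NNReal.coe_lt_coe]
          push_cast
          exact hk
      rw [indicator_of_mem hω, Pi.one_apply]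
    · rw [if_neg hk]
      exact bot_le
  -- integrate
  calc ∫⁻ ω, ENNReal.ofReal (brownianExitTimeReal a b ω ^ 2) ∂Process.preWienerMeasure
      ≤ ∫⁻ ω, ENNReal.ofReal ((h : ℝ) ^ 2) *
          ∑' k : ℕ, ((2 * k + 1 : ℕ) : ℝ≥0∞) * (E k).indicator 1 ω ∂Process.preWienerMeasure :=
        lintegral_mono hpt
    _ = ENNReal.ofReal ((h : ℝ) ^ 2) *
          ∑' k : ℕ, ((2 * k + 1 : ℕ) : ℝ≥0∞) * Process.preWienerMeasure (E k) := by
        rw [lintegral_const_mul' _ _ ENNReal.ofReal_ne_top, lintegral_tsum]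
        · congr 1
          refine tsum_congr fun k ↦ ?_
          rw [lintegral_const_mul' _ _ (ENNReal.natCast_ne_top _), lintegral_indicator_one (hEm k)]
        · intro k
          exact (((measurable_const.indicator (hEm k))).const_mul _).aemeasurable
    _ ≤ ENNReal.ofReal ((b - a) ^ 4) *
          ∑' k : ℕ, ((2 * k + 1 : ℕ) : ℝ≥0∞) * gaussianReal 0 1 (Ioo (-1) 1) ^ k := by
        rw [hhr, show ((b - a) ^ 2) ^ 2 = (b - a) ^ 4 by ring]
        gcongr with k
        exact measure_mul_lt_exitTime_brownian_le_pow hab hhr k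

/-- The series `∑ₖ (2k + 1) θ₀^k` in `ℝ≥0∞` equals `(1 + θ₀)/(1 - θ₀)²` (read through `ofReal`).
[folklore] -/
theorem tsum_two_mul_add_one_mul_gaussianReal_pow :
    ∑' k : ℕ, ((2 * k + 1 : ℕ) : ℝ≥0∞) * gaussianReal 0 1 (Ioo (-1) 1) ^ k =
      ENNReal.ofReal ((1 + (gaussianReal 0 1).real (Ioo (-1) 1)) /
        (1 - (gaussianReal 0 1).real (Ioo (-1) 1)) ^ 2) := by
  set θ := (gaussianReal 0 1).real (Ioo (-1) 1) with hθ
  have h0 : 0 ≤ θ := measureReal_nonneg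
  have h1 : θ < 1 := gaussianReal_real_Ioo_neg_one_one_lt_one
  have hθ' : gaussianReal 0 1 (Ioo (-1) 1) = ENNReal.ofReal θ := by
    rw [hθ, measureReal_def, ENNReal.ofReal_toReal (measure_ne_top _ _)]
  have hsum := hasSum_two_mul_add_one_mul_pow h0 h1
  rw [← hsum.tsum_eq, ENNReal.ofReal_tsum_of_nonneg (fun k ↦ by positivity) hsum.summable]
  refine tsum_congr fun k ↦ ?_
  rw [hθ', ← ENNReal.ofReal_pow h0, ENNReal.ofReal_mul' (pow_nonneg h0 _)]
  congr 1
  rw [ENNReal.ofReal_natCast]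

/-- **The Brownian exit time of `(a, b)` has a finite second moment** (`a < 0 < b`).
Durrett (2019), §7.5 (Thm. 7.5.9, Exercise 7.5.4). [folklore] -/
theorem integrable_brownianExitTimeReal_sq (ha : a < 0) (hb : 0 < b) :
    Integrable (fun ω ↦ brownianExitTimeReal a b ω ^ 2) Process.preWienerMeasure := by
  refine ⟨((measurable_brownianExitTimeReal a b).pow_const 2).aestronglyMeasurable, ?_⟩
  rw [hasFiniteIntegral_iff_ofReal (ae_of_all _ fun ω ↦ sq_nonneg _)]
  refine (lintegral_brownianExitTimeReal_sq_le ha hb).trans_lt ?_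
  rw [tsum_two_mul_add_one_mul_gaussianReal_pow]
  exact ENNReal.mul_lt_top ENNReal.ofReal_lt_top ENNReal.ofReal_lt_top

/-- The real-valued exit time is square integrable (`a < 0 < b`). [folklore] -/
theorem memLp_two_brownianExitTimeReal (ha : a < 0) (hb : 0 < b) :
    MemLp (brownianExitTimeReal a b) 2 Process.preWienerMeasure :=
  (memLp_two_iff_integrable_sq (measurable_brownianExitTimeReal a b).aestronglyMeasurable).2
    (integrable_brownianExitTimeReal_sq ha hb)

/-- **Second moment of the Brownian exit time of `(a, b)`** (`a < 0 < b`):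
`E[τ²] ≤ 2 / (1 - θ₀)² · (b - a)⁴` with the universal constant `θ₀ = P[|N(0,1)| < 1] < 1`.
This is the bound "`E[(τ_{n+1} - τ_n)² | B[0, τ_n]] = O(δ⁴)`" of Lawler–Schramm–Werner (2004),
proof of Thm. 3.7 (there `b - a ≤ 4δ`); cf. Durrett (2019), Thm. 7.5.9 (`E T² = 5a⁴/3` for the
symmetric interval) and Exercise 7.5.4. [cite: LawlerSchrammWerner2004, Lemma 3.8] -/
theorem integral_brownianExitTimeReal_sq_le (ha : a < 0) (hb : 0 < b) :
    ∫ ω, brownianExitTimeReal a b ω ^ 2 ∂Process.preWienerMeasure ≤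
      2 / (1 - (gaussianReal 0 1).real (Ioo (-1) 1)) ^ 2 * (b - a) ^ 4 := by
  set θ := (gaussianReal 0 1).real (Ioo (-1) 1) with hθ
  have h0 : 0 ≤ θ := measureReal_nonneg
  have h1 : θ < 1 := gaussianReal_real_Ioo_neg_one_one_lt_one
  have hpos : 0 < (1 - θ) ^ 2 := by nlinarith
  have hlint := lintegral_brownianExitTimeReal_sq_le ha hb
  rw [tsum_two_mul_add_one_mul_gaussianReal_pow, ← ENNReal.ofReal_mul (by positivity)] at hlint
  rw [integral_eq_lintegral_of_nonneg_ae (ae_of_all _ fun ω ↦ sq_nonneg _)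
    ((measurable_brownianExitTimeReal a b).pow_const 2).aestronglyMeasurable]
  calc (∫⁻ ω, ENNReal.ofReal (brownianExitTimeReal a b ω ^ 2) ∂Process.preWienerMeasure).toReal
      ≤ (b - a) ^ 4 * ((1 + θ) / (1 - θ) ^ 2) :=
        ENNReal.toReal_le_of_le_ofReal (by positivity) hlint
    _ ≤ 2 / (1 - θ) ^ 2 * (b - a) ^ 4 := by
        rw [mul_comm]
        gcongr
        linarith

end Literature.Probability.RandomPlanarGeometry
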